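import Mathlib
import HarnessLib
import Summits.ResolutionOfSingularities.ResolutionOfSingularities.Theorems.WildQuotientsWildQuotientResolutionS1aChartRingSigma
import Summits.ResolutionOfSingularities.ResolutionOfSingularities.Theorems.WildQuotientsWildQuotientResolutionS1aOneShotKillRing

/-!
# S1a — (T2, chart form) ONE-SHOT KILL ON THE CHART RINGS OF THE MOVE: `I_{σʼ} = (s)` on `R^w[(bT^d)⁻¹]`

[OURS · L1 W4.5c · lead-1 g6; plan-1 SIG `W45cT2Signatures.lean` f384756d9d5bd870 §5 «Rees-model facts from your A5b
chart files → (T2e)»] — NOT a statement of the manuscript; counted 0; AI-level work, weaker than expert review. Crux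
stmt-ResolutionOfSingularities-17941, line `s1a-logminvertex` v6, stub `stub_winningStrategy` ((R0) branch).

The abstract one-shot kill (T2a `…S1aOneShotKill`, T2c `…S1aOneShotKillRing`) instantiated on the ACTUAL chart rings of the
move (H4a `CoarseChart.ChartRing 𝒜 f w d b hb = R^w[(b T^d)⁻¹]`, `R^w = B[s, f_i T^{w_i}]` the cobordant algebra, with the
transported automorphism `σʼ = sigmaChart`): the REES-MODEL FACTS
* `algebraMap_eq_CT_mul_s_pow` / `algebraMap_mem_span_s_pow` — `y ∈ K n ⇒ y = (y Tⁿ) · sⁿ` in `R^w`;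
* `mem_span_u'_of_coe_eq` / `coverElement_mem_span_u'` — positive-weight monomials `y Tⁿ` lie in the ideal of the
  `u'_i = f_i T^{w_i}`; in particular the cover element `b T^d` (`d ≥ 1`) does;
* `sigmaR_sub_mem_span_s` — gr-TRIVIALITY on `R^w`: `σ_R z − z ∈ (s)` as soon as `σ y − y ∈ K 1` (all `y`) and
  `σ f_i − f_i ∈ K (w_i + 1)` (induction on the generators `B`, `s`, `u'_i` of `R^w`);
* `sigmaChart_sub_mem_span_s` — the same on the chart ring (clear the unit denominator `(bT^d)^k`);
and the theorem **`augmentationIdeal_sigmaChart_eq_span_s`**: for a centre with `f_i ∈ I_σ ≤ K 1`, DEPTH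
`σ f_i − f_i ∈ K (w_i + 1)`, HEADS or UNIT SUCCESSORS, `0 < w_i`, `1 ≤ d`, and a `σ`-invariant cover element `b ∈ K d`:
`augmentationIdeal σʼ = (s)` on `R^w[(bT^d)⁻¹]` — the lifted automorphism is Király–Lütkebohmert-KILLED along the
whole exceptional divisor `V(s)` of every chart of the move.
-/

set_option linter.dupNamespace false

noncomputable section

open LaurentPolynomial
open Literature.AlgebraicGeometry.Resolution
open Summit.ResolutionOfSingularities.ResolutionOfSingularities.Theorems.WildQuotientResolution.S1.CoarseChart

namespace Summit.ResolutionOfSingularities.ResolutionOfSingularities.Theorems.WildQuotientResolution.S1.OneShotKill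

universe u v

/-! ## Rees-model facts in the cobordant algebra `R^w` -/

section ReesModel

variable {B : Type u} [CommRing B] {c : ℕ} (f : Fin c → B) (w : Fin c → ℕ)

/-- `y ∈ K n ⇒ y = (y Tⁿ) · sⁿ` in `R^w`. -/
theorem algebraMap_eq_CT_mul_s_pow {n : ℕ} {y : B} (hy : y ∈ (weightedFiltration f w).ideal n) :
    algebraMap B (↥(cobordantAlgebra f w)) y =
      (⟨C y * T (n : ℤ), C_mul_T_mem_cobordantAlgebra f w hy⟩ : ↥(cobordantAlgebra f w)) *
        cobordantAlgebra.s f w ^ n := by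
  apply Subtype.ext
  rw [cobordantAlgebra.coe_algebraMap, MulMemClass.coe_mul, cobordantAlgebra.coe_s_pow, mul_assoc, ← T_add,
    add_neg_cancel, T_zero, mul_one]

/-- `y ∈ K n ⇒ y ∈ (sⁿ)` in `R^w`. -/
theorem algebraMap_mem_span_s_pow {n : ℕ} {y : B} (hy : y ∈ (weightedFiltration f w).ideal n) :
    algebraMap B (↥(cobordantAlgebra f w)) y ∈ Ideal.span {cobordantAlgebra.s f w ^ n} :=
  Ideal.mem_span_singleton'.mpr ⟨_, (algebraMap_eq_CT_mul_s_pow f w hy).symm⟩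

/-- The generators `u'_i = f_i T^{w_i}` in coordinates. -/
theorem u'_eq (i : Fin c) :
    cobordantAlgebra.u' f w i = ⟨C (f i) * T (w i : ℤ), cobordantAlgebra.C_mul_T_mem f w i⟩ := rfl

/-- **Positive-weight monomials lie in the ideal of the `u'_i`**: every element of `R^w` of the form `y Tⁿ` with
`y ∈ K n`, `n ≥ 1`, lies in `(u'_1, …, u'_c)`. -/
theorem mem_span_u'_of_coe_eq {n : ℕ} (hn : 1 ≤ n) {y : B} (hy : y ∈ (weightedFiltration f w).ideal n) :
    ∀ z : ↥(cobordantAlgebra f w), (z : B[T;T⁻¹]) = C y * T (n : ℤ) →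
      z ∈ Ideal.span (Set.range (cobordantAlgebra.u' f w)) := by
  classical
  rw [weightedFiltration_ideal] at hy
  induction hy using Submodule.span_induction with
  | mem m hm =>
    obtain ⟨α, hα, rfl⟩ := hm
    intro z hz
    -- `α ≠ 0`: pick `j ∈ α.support`
    have hα0 : α.support.Nonempty := by
      rw [Finset.nonempty_iff_ne_empty, Ne, Finsupp.support_eq_empty]
      rintro rfl
      simp only [map_zero] at hα
      omega
    obtain ⟨j, hj⟩ := hα0
    -- `z = (∏ u'^α) · s^(weight α - n)`
    have hz' : z = (α.prod fun i e => cobordantAlgebra.u' f w i ^ e) *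
        cobordantAlgebra.s f w ^ (Finsupp.weight w α - n) := by
      apply Subtype.ext
      rw [hz, MulMemClass.coe_mul, coe_prod_u'_pow, cobordantAlgebra.coe_s_pow, mul_assoc, ← T_add]
      congr 2
      rw [Nat.cast_sub hα]
      ring
    rw [hz']
    refine Ideal.mul_mem_right _ _ ?_
    rw [← Finsupp.mul_prod_erase α j _ hj]
    refine Ideal.mul_mem_right _ _ ?_
    have hαj : α j = (α j - 1) + 1 := (Nat.sub_add_cancel (Nat.pos_of_ne_zero (Finsupp.mem_support_iff.mp hj))).symm
    rw [hαj, pow_succ]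
    exact Ideal.mul_mem_left _ _ (Ideal.subset_span ⟨j, rfl⟩)
  | zero =>
    intro z hz
    rw [map_zero, zero_mul] at hz
    have : z = 0 := Subtype.ext hz
    rw [this]; exact Ideal.zero_mem _
  | add y₁ y₂ hy₁ hy₂ ih₁ ih₂ =>
    intro z hz
    have h₁ : C y₁ * T (n : ℤ) ∈ cobordantAlgebra f w := C_mul_T_mem_cobordantAlgebra f w hy₁
    have h₂ : C y₂ * T (n : ℤ) ∈ cobordantAlgebra f w := C_mul_T_mem_cobordantAlgebra f w hy₂
    have : z = ⟨_, h₁⟩ + ⟨_, h₂⟩ := Subtype.ext (by rw [hz, AddMemClass.coe_add, map_add, add_mul])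
    rw [this]
    exact Ideal.add_mem _ (ih₁ _ rfl) (ih₂ _ rfl)
  | smul a y hy ih =>
    intro z hz
    have h₁ : C y * T (n : ℤ) ∈ cobordantAlgebra f w := C_mul_T_mem_cobordantAlgebra f w hy
    have : z = algebraMap B (↥(cobordantAlgebra f w)) a * ⟨_, h₁⟩ :=
      Subtype.ext (by rw [hz, MulMemClass.coe_mul, cobordantAlgebra.coe_algebraMap, smul_eq_mul, map_mul, mul_assoc])
    rw [this]
    exact Ideal.mul_mem_left _ _ (ih _ rfl)

end ReesModel

/-! ## gr-triviality on `R^w` and on the chart ring -/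

section GrTriv

variable {ι : Type v} [AddCommGroup ι] [DecidableEq ι] {B : Type u} [CommRing B]
  (𝒜 : ι → AddSubgroup B) [GradedRing 𝒜] {c : ℕ} (f : Fin c → B) (w : Fin c → ℕ)
  (d : ℕ) (b : ↥(𝒜 0)) (hb : b ∈ (traceFiltration 𝒜 f w).ideal d) (σ : B ≃+* B)
  (hσJ : ∀ n : ℕ, ((weightedFiltration f w).ideal n).map (σ : B →+* B) ≤ (weightedFiltration f w).ideal n)
  {p : ℕ} (hp : 0 < p) (hσp : ∀ x : B, (⇑σ)^[p] x = x) (hσb : σ (b : B) = b)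

/-- **The cover element `b T^d` (`d ≥ 1`) lies in the ideal of the `u'_i`.** -/
theorem coverElement_mem_span_u' (hd : 1 ≤ d) :
    coverElement 𝒜 f w d b hb ∈ Ideal.span (Set.range (cobordantAlgebra.u' f w)) :=
  mem_span_u'_of_coe_eq f w hd hb _ (coe_coverElement 𝒜 f w d b hb)

include hσJ hp hσp in
/-- **gr-TRIVIALITY on `R^w`**: `σ_R z − z ∈ (s)` for all `z`, from `σ y − y ∈ K 1` and DEPTH. Induction on the generators
`B`, `s`, `u'_i` of `R^w`. [OURS · L1 W4.5c] -/
theorem sigmaR_sub_mem_span_s (h1 : ∀ y : B, σ y - y ∈ (weightedFiltration f w).ideal 1)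
    (hdepth : ∀ i, σ (f i) - f i ∈ (weightedFiltration f w).ideal (w i + 1)) (z : ↥(cobordantAlgebra f w)) :
    sigmaR σ f w hσJ hp hσp z - z ∈ Ideal.span {cobordantAlgebra.s f w} := by
  induction z using cobordantAlgebra.induction_on with
  | algebraMap a =>
    rw [sigmaR_algebraMap, ← map_sub]
    have := algebraMap_mem_span_s_pow f w (h1 a)
    rwa [pow_one] at this
  | s => rw [sigmaR_s, sub_self]; exact Ideal.zero_mem _
  | u' i =>
    have hmem : C (σ (f i) - f i) * T ((w i : ℤ) + 1) ∈ cobordantAlgebra f w := by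
      have := C_mul_T_mem_cobordantAlgebra f w (hdepth i); exact_mod_cast this
    have key : sigmaR σ f w hσJ hp hσp (cobordantAlgebra.u' f w i) - cobordantAlgebra.u' f w i =
        (⟨_, hmem⟩ : ↥(cobordantAlgebra f w)) * cobordantAlgebra.s f w := by
      apply Subtype.ext
      rw [AddSubgroupClass.coe_sub, MulMemClass.coe_mul, cobordantAlgebra.coe_s, u'_eq, sigmaR_mk]
      show C (σ (f i)) * T (w i : ℤ) - C (f i) * T (w i : ℤ) = C (σ (f i) - f i) * T ((w i : ℤ) + 1) * T (-1)
      rw [mul_assoc, ← T_add, add_neg_cancel_right, map_sub, sub_mul]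
    rw [key]
    exact Ideal.mul_mem_left _ _ (Ideal.mem_span_singleton_self _)
  | add z₁ z₂ h₁ h₂ =>
    have : sigmaR σ f w hσJ hp hσp (z₁ + z₂) - (z₁ + z₂) =
        (sigmaR σ f w hσJ hp hσp z₁ - z₁) + (sigmaR σ f w hσJ hp hσp z₂ - z₂) := by rw [map_add]; ring
    rw [this]; exact Ideal.add_mem _ h₁ h₂
  | mul z₁ z₂ h₁ h₂ =>
    have : sigmaR σ f w hσJ hp hσp (z₁ * z₂) - z₁ * z₂ =
        sigmaR σ f w hσJ hp hσp z₁ * (sigmaR σ f w hσJ hp hσp z₂ - z₂) + (sigmaR σ f w hσJ hp hσp z₁ - z₁) * z₂ := by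
      rw [map_mul]; ring
    rw [this]; exact Ideal.add_mem _ (Ideal.mul_mem_left _ _ h₂) (Ideal.mul_mem_right _ _ h₁)

include hp hσp in
/-- **gr-TRIVIALITY on the chart ring** `R^w[(bT^d)⁻¹]`: `σʼ x − x ∈ (s)` for all `x`. -/
theorem sigmaChart_sub_mem_span_s (h1 : ∀ y : B, σ y - y ∈ (weightedFiltration f w).ideal 1)
    (hdepth : ∀ i, σ (f i) - f i ∈ (weightedFiltration f w).ideal (w i + 1)) (x : ChartRing 𝒜 f w d b hb) :
    sigmaChart 𝒜 f w d b hb σ hσJ hp hσp hσb x - x ∈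
      Ideal.span {algebraMap _ (ChartRing 𝒜 f w d b hb) (cobordantAlgebra.s f w)} := by
  obtain ⟨z, ⟨_, k, rfl⟩, hx⟩ := IsLocalization.exists_mk'_eq (Submonoid.powers (coverElement 𝒜 f w d b hb)) x
  have hU : IsUnit (algebraMap _ (ChartRing 𝒜 f w d b hb) (coverElement 𝒜 f w d b hb ^ k)) := by
    rw [map_pow]; exact (IsLocalization.Away.algebraMap_isUnit (coverElement 𝒜 f w d b hb)).pow k
  have h1' : x * algebraMap _ (ChartRing 𝒜 f w d b hb) (coverElement 𝒜 f w d b hb ^ k) = algebraMap _ _ z := by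
    rw [← hx]; exact IsLocalization.mk'_spec _ _ _
  have h2 : sigmaChart 𝒜 f w d b hb σ hσJ hp hσp hσb x *
      algebraMap _ (ChartRing 𝒜 f w d b hb) (coverElement 𝒜 f w d b hb ^ k) =
      algebraMap _ _ (sigmaR σ f w hσJ hp hσp z) := by
    have := congrArg (sigmaChart 𝒜 f w d b hb σ hσJ hp hσp hσb) h1'
    rw [map_mul, sigmaChart_algebraMap, sigmaChart_algebraMap, map_pow,
      sigmaR_coverElement 𝒜 f w d b hb σ hσJ hp hσp hσb] at this
    exact this
  have h3 : (sigmaChart 𝒜 f w d b hb σ hσJ hp hσp hσb x - x) *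
      algebraMap _ (ChartRing 𝒜 f w d b hb) (coverElement 𝒜 f w d b hb ^ k) =
      algebraMap _ _ (sigmaR σ f w hσJ hp hσp z - z) := by rw [sub_mul, h1', h2, map_sub]
  obtain ⟨z', hz'⟩ := Ideal.mem_span_singleton'.mp (sigmaR_sub_mem_span_s f w σ hσJ hp hσp h1 hdepth z)
  rw [← Ideal.mul_unit_mem_iff_mem _ hU, h3, ← hz', map_mul]
  exact Ideal.mul_mem_left _ _ (Ideal.mem_span_singleton_self _)

/-- `s` is a non-zero-divisor of the chart ring. -/
theorem algebraMap_s_mem_nonZeroDivisors :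
    algebraMap _ (ChartRing 𝒜 f w d b hb) (cobordantAlgebra.s f w) ∈ nonZeroDivisors (ChartRing 𝒜 f w d b hb) :=
  IsLocalization.nonZeroDivisors_le_comap (Submonoid.powers (coverElement 𝒜 f w d b hb)) (ChartRing 𝒜 f w d b hb)
    (cobordantAlgebra.s_mem_nonZeroDivisors f w)

/-- The strict-transform coordinates `u'_i` generate the unit ideal of the chart ring (`d ≥ 1`). -/
theorem span_algebraMap_u'_eq_top (hd : 1 ≤ d) :
    Ideal.span (Set.range fun i => algebraMap _ (ChartRing 𝒜 f w d b hb) (cobordantAlgebra.u' f w i)) = ⊤ := by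
  refine Ideal.eq_top_of_isUnit_mem _ ?_ (IsLocalization.Away.algebraMap_isUnit (coverElement 𝒜 f w d b hb))
  have := Ideal.mem_map_of_mem (algebraMap _ (ChartRing 𝒜 f w d b hb)) (coverElement_mem_span_u' 𝒜 f w d b hb hd)
  rw [Ideal.map_span, ← Set.range_comp] at this
  exact this

include hp hσp in
/-- **(T2, chart form) ONE-SHOT KILL on `R^w[(bT^d)⁻¹]`**: for a centre `(f, w)` with `f_i ∈ I_σ`, `σ y − y ∈ K 1`
for all `y`, DEPTH `σ f_i − f_i ∈ K (w_i + 1)`, every `f_i` a HEAD (`w_i = 1`) or a UNIT SUCCESSOR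
(`σ f_h − f_h − u f_i ∈ K (w_h + 2)`, `w_i = w_h + 1`, `u` a unit mod `K 1`), `0 < w_i`, `1 ≤ d` and a `σ`-invariant
cover element `b ∈ K d`: the augmentation ideal of `σʼ = sigmaChart` is `(s)`. [OURS · L1 W4.5c] -/
theorem augmentationIdeal_sigmaChart_eq_span_s (hw : ∀ i, 0 < w i) (hd : 1 ≤ d)
    (hfI : ∀ i, f i ∈ augmentationIdeal σ) (h1 : ∀ y : B, σ y - y ∈ (weightedFiltration f w).ideal 1)
    (hdepth : ∀ i, σ (f i) - f i ∈ (weightedFiltration f w).ideal (w i + 1))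
    (hD2 : ∀ i, w i = 1 ∨ ∃ (h : Fin c) (u : B), w i = w h + 1 ∧
      IsUnit (Ideal.Quotient.mk ((weightedFiltration f w).ideal 1) u) ∧
      σ (f h) - f h - u * f i ∈ (weightedFiltration f w).ideal (w h + 2)) :
    augmentationIdeal (sigmaChart 𝒜 f w d b hb σ hσJ hp hσp hσb) =
      Ideal.span {algebraMap _ (ChartRing 𝒜 f w d b hb) (cobordantAlgebra.s f w)} := by
  letI : Algebra B (ChartRing 𝒜 f w d b hb) :=
    ((algebraMap _ (ChartRing 𝒜 f w d b hb)).comp (algebraMap B (↥(cobordantAlgebra f w)))).toAlgebra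
  have halg : ∀ y : B, algebraMap B (ChartRing 𝒜 f w d b hb) y =
      algebraMap _ (ChartRing 𝒜 f w d b hb) (algebraMap B (↥(cobordantAlgebra f w)) y) := fun _ => rfl
  have hcompat : ∀ y : B, sigmaChart 𝒜 f w d b hb σ hσJ hp hσp hσb (algebraMap B (ChartRing 𝒜 f w d b hb) y) =
      algebraMap B (ChartRing 𝒜 f w d b hb) (σ y) := fun y => by
    rw [halg, halg]; exact sigmaChart_algebraMap_algebraMap 𝒜 f w d b hb σ hσJ hp hσp hσb y
  have hfg : ∀ j, algebraMap B (ChartRing 𝒜 f w d b hb) (f j) =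
      algebraMap _ (ChartRing 𝒜 f w d b hb) (cobordantAlgebra.u' f w j) *
        algebraMap _ (ChartRing 𝒜 f w d b hb) (cobordantAlgebra.s f w) ^ (w j) := fun j => by
    rw [halg, cobordantAlgebra.algebraMap_u, map_mul, map_pow, mul_comm]
  have hK : ∀ (n : ℕ) (y : B), y ∈ (weightedFiltration f w).ideal n →
      algebraMap B (ChartRing 𝒜 f w d b hb) y ∈
        Ideal.span {algebraMap _ (ChartRing 𝒜 f w d b hb) (cobordantAlgebra.s f w) ^ n} := fun n y hy => by
    rw [halg, ← map_pow]
    have := Ideal.mem_map_of_mem (algebraMap _ (ChartRing 𝒜 f w d b hb)) (algebraMap_mem_span_s_pow f w hy)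
    rwa [Ideal.map_span, Set.image_singleton] at this
  refine augmentationIdeal_eq_span_of_oneShot σ (sigmaChart 𝒜 f w d b hb σ hσJ hp hσp hσb) hcompat
    (fun i => algebraMap _ (ChartRing 𝒜 f w d b hb) (cobordantAlgebra.u' f w i)) w
    (algebraMap _ (ChartRing 𝒜 f w d b hb) (cobordantAlgebra.s f w))
    (span_algebraMap_u'_eq_top 𝒜 f w d b hb hd) (fun i => ⟨hw i, ?_⟩)
    (sigmaChart_sub_mem_span_s 𝒜 f w d b hb σ hσJ hp hσp hσb h1 hdepth) fun i => ?_
  · rw [← hfg i]; exact Ideal.mem_map_of_mem _ (hfI i)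
  · rcases hD2 i with hhead | ⟨h, u, hwi, hu, hrel⟩
    · exact Or.inl hhead
    · exact Or.inr ⟨h, algebraMap B _ u,
        isUnit_mk_span_of_isUnit_mk f w (algebraMap _ (ChartRing 𝒜 f w d b hb) (cobordantAlgebra.s f w)) hK hu,
        unitSuccessorFormula σ (sigmaChart 𝒜 f w d b hb σ hσJ hp hσp hσb) f w
          (fun i => algebraMap _ (ChartRing 𝒜 f w d b hb) (cobordantAlgebra.u' f w i))
          (algebraMap _ (ChartRing 𝒜 f w d b hb) (cobordantAlgebra.s f w)) hcompat
          (algebraMap_s_mem_nonZeroDivisors 𝒜 f w d b hb) (sigmaChart_s 𝒜 f w d b hb σ hσJ hp hσp hσb)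
          hfg hK h i u hwi hrel⟩

end GrTriv

end Summit.ResolutionOfSingularities.ResolutionOfSingularities.Theorems.WildQuotientResolution.S1.OneShotKill

end
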